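import Mathlib.Analysis.Convex.Deriv
import Mathlib.Analysis.SpecialFunctions.Log.Deriv
import Mathlib.Analysis.SpecialFunctions.ExpDeriv
import Mathlib.Analysis.SpecialFunctions.Pow.Real
import HarnessLib

/-!
# The NON-port components of `(Q6)` under pendant extension — flow / tangency proof, part 1: the tangency inequality

Support file for crux `stmt-CriticalPhenomena-4575` (`NoHeavyLowerTail`), seat `prim-l12-p1` gen 22
(`--supports stmt-CriticalPhenomena-4575`; memo `run/shared/lean/prim/prim-l12/FROM-prim-l12-p1-g22-*.md`).
No definitions, no sorries, standard axioms.  An INDEPENDENT proof of the statement of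
`ThreePointIsoSexticPendantNonPort` (prim-facecert gen 19, Bernstein certificate for `(log E)' ≥ 0 ⟹ K ≥ 1`) / lead gen 117
(Handelman certificate, memo `FROM-prim-nh-lead-4575-g117-NONPORT-Q6.md`); the three proofs were found in parallel on 2026-08-23.

Cells of the partition law of three terminals `a, b, h`: `x = P(abh)`, `s = P(ab|h)`, `t = P(ah|b)`, `u = P(bh|a)`, `q = P(a|b|h)`,
nonnegative with `x+s+t+u+q = 1`; isolation coordinates `Q = q`, `I_a = q+u`, `I_b = q+t`, `I_h = q+s`.  The sextic law `(Q6)` is the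
system `Q⁶ ≤ I_a³I_b³I_h²` (port component at `h`), `Q⁶ ≤ I_b³I_h³I_a²` (component of `a`), `Q⁶ ≤ I_a³I_h³I_b²` (component of `b`).
PENDANT EXTENSION of `h` with contact probability `p ∈ [0,1]` has the cells `x' = px`, `s' = s+(1−p)x`, `t' = pt`, `u' = pu`,
`q' = q+(1−p)(t+u)` (`TerminalGluing.PrW_pendant_*`), hence `Q' = q+(1−p)(t+u)`, `I_a' = q+u+(1−p)t`, `I_b' = q+t+(1−p)u`,
`I_w' = q+s+(1−p)(x+t+u)`.

**THEOREM (`isoSexticA_pendant`, `isoSexticB_pendant`).**  `q⁶ ≤ (q+t)³(q+s)³(q+u)² ⟹ Q'⁶ ≤ I_b'³·I_w'³·I_a'²` for every `p ∈ [0,1]` (and the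
same with `a ↔ b`): each non-port component ALONE is preserved — on the law simplex (it is false if `s < 0` is allowed; the statement is not
scale-free).

PROOF (flow / tangency).  Pendant extensions form a one-parameter semigroup (`(L_p)_{p'} = L_{pp'}`) and the law simplex is invariant under it,
so it is enough that the margin `μ(p) = I_b'³I_w'³I_a'² − Q'⁶` (a polynomial of degree 8, `μ(1) ≥ 0` by hypothesis) cannot cross zero downwards
as `p` decreases: at every zero `p₀ ∈ (0,1]` of `μ`, `p₀·μ'(p₀)` equals the tangency form of the boundary law `L_{p₀}`,
`D = −3u·I_b²I_h³I_a² − 3(x+t+u)·I_b³I_h²I_a² − 2t·I_b³I_h³I_a + 6(t+u)q⁵` (`margin_deriv_scale`), and **`D ≤ 0` on the boundary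
`{Q⁶ = I_b³I_h³I_a²}`, with equality iff `t = s = 0`** (then `x = 0`, `u = 1−q`: the `a`-isolated family, on which `μ ≡ 0`) (`key_tangency`).
The tangency inequality reads `6(t+u) ≤ q·(2t/I_a + 3u/I_b + 3(x+t+u)/I_h)`; on the boundary `I_h ≥ q` gives `q⁵ ≥ I_a²I_b³I_h²`, hence
`q⁴ ≥ I_a R³ I_h` with `R² = q·I_b`, and the remainder is the polynomial inequality `key_poly`, whose normal form
`r²(1+υ)·Δ = c₀ + c₁υ + c₂υ²` (`r = R/q ≥ 1`, `υ = u/q`) has the nonnegative coefficients `c₀ = r²(r−1)(3r²−r−1)`, `c₁ = (r−1)(6r⁴−3r−3)`,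
`c₂ = 3(r−1)(r⁴+r³+r²−r−1)` (raw identity `P·q³ = (T₀+T₁+T₂)·q² + M·(qt − R² + q²)`).  The real-analysis shell is `nonneg_of_tangency`: a
differentiable `f` with `f(1) ≥ 0` whose derivative is `< 0` at every zero in `(0,1]` unless `f ≡ 0` is `≥ 0` on `[0,1]` (sup argument + slope limit).
With the port lemma (`ThreePointIsoSexticPendant`, `ThreePointIsoSexticPendantConvex`), product stability and the terminal-edge identities this gives
the full `(Q6)` system on the series–parallel graph closure (`…ThreePointIsoSexticSPClosure`).
-/

namespace Summit.CriticalPhenomena.PercolationContinuityZ3.Theorems.ThreePointIsoSexticPendantFlow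

open Set Filter Topology

/-! ## 1. A real-analysis lemma: no downward zero-crossing -/

/-- If `f` is differentiable on `ℝ`, `f 1 ≥ 0`, and at every zero `p ∈ (0,1]` of `f` either `f' p < 0` or `f` vanishes identically,
then `f ≥ 0` on `[0,1]`. [folklore] -/
theorem nonneg_of_tangency (f f' : ℝ → ℝ) (hder : ∀ p, HasDerivAt f (f' p) p) (h1 : 0 ≤ f 1)
    (hkey : ∀ p, 0 < p → p ≤ 1 → f p = 0 → f' p < 0 ∨ ∀ y, f y = 0) :
    ∀ p ∈ Icc (0 : ℝ) 1, 0 ≤ f p := by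
  have hcont : Continuous f := continuous_iff_continuousAt.2 fun p => (hder p).continuousAt
  intro p₁ hp₁
  by_contra hneg
  push Not at hneg
  set S : Set ℝ := {p | p ∈ Icc p₁ 1 ∧ f p < 0} with hS
  have hS₁ : p₁ ∈ S := ⟨⟨le_rfl, hp₁.2⟩, hneg⟩
  have hne : S.Nonempty := ⟨p₁, hS₁⟩
  have hbdd : BddAbove S := ⟨1, fun p hp => hp.1.2⟩
  set p₂ := sSup S with hp₂
  have h12 : p₁ ≤ p₂ := le_csSup hbdd hS₁
  have h21 : p₂ ≤ 1 := csSup_le hne fun p hp => hp.1.2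
  -- `f p₂ ≤ 0`
  have hle : f p₂ ≤ 0 := by
    by_contra h
    push Not at h
    obtain ⟨δ, hδ, hball⟩ := Metric.eventually_nhds_iff.1 ((hcont.continuousAt (x := p₂)).eventually (eventually_gt_nhds h))
    have hub : p₂ ≤ p₂ - δ := by
      refine csSup_le hne fun p hp => ?_
      by_contra hc
      push Not at hc
      have hpp : p ≤ p₂ := le_csSup hbdd hp
      have hd : dist p p₂ < δ := by
        rw [Real.dist_eq, abs_lt]; constructor <;> linarith
      exact absurd (hball hd) (not_lt.2 hp.2.le)
    linarith
  -- `0 ≤ f p₂`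
  have hge : 0 ≤ f p₂ := by
    by_contra h
    push Not at h
    have hlt1 : p₂ < 1 := lt_of_le_of_ne h21 fun he => by rw [he] at h; exact absurd h1 (not_le.2 h)
    obtain ⟨δ, hδ, hball⟩ := Metric.eventually_nhds_iff.1 ((hcont.continuousAt (x := p₂)).eventually (eventually_lt_nhds h))
    set p' := min (p₂ + δ / 2) 1 with hp'
    have hp'gt : p₂ < p' := lt_min (by linarith) hlt1
    have hd : dist p' p₂ < δ := by
      rw [Real.dist_eq, abs_lt]
      constructor
      · linarith
      · have : p' ≤ p₂ + δ / 2 := min_le_left _ _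
        linarith
    have hp'S : p' ∈ S := ⟨⟨by linarith, min_le_right _ _⟩, hball hd⟩
    have : p' ≤ p₂ := le_csSup hbdd hp'S
    linarith
  have hzero : f p₂ = 0 := le_antisymm hle hge
  have h12' : p₁ < p₂ := lt_of_le_of_ne h12 fun he => by rw [← he] at hzero; linarith
  have hpos : 0 < p₂ := lt_of_le_of_lt hp₁.1 h12'
  rcases hkey p₂ hpos h21 hzero with hd | hall
  · -- negative derivative: `f > 0` immediately to the left of `p₂`, contradicting `p₂ = sup S`
    have ht : Tendsto (slope f p₂) (𝓝[<] p₂) (𝓝 (f' p₂)) :=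
      (hasDerivAt_iff_tendsto_slope_left_right.1 (hder p₂)).1
    have hev : ∀ᶠ p in 𝓝[<] p₂, slope f p₂ p < 0 := ht.eventually (eventually_lt_nhds hd)
    obtain ⟨l, hl, hsub⟩ := mem_nhdsLT_iff_exists_Ioo_subset.1 hev
    have hub : p₂ ≤ max l p₁ := by
      refine csSup_le hne fun p hp => ?_
      by_contra hc
      push Not at hc
      have hpp : p ≤ p₂ := le_csSup hbdd hp
      have hpne : p ≠ p₂ := fun he => by rw [he] at hp; linarith [hp.2]
      have hplt : p < p₂ := lt_of_le_of_ne hpp hpne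
      have hpl : l < p := lt_of_le_of_lt (le_max_left _ _) hc
      have hsl : slope f p₂ p < 0 := hsub ⟨hpl, hplt⟩
      rw [slope_def_field, hzero, sub_zero] at hsl
      have hfp : 0 < f p := by
        have hden : p - p₂ < 0 := by linarith
        by_contra hf
        push Not at hf
        exact absurd (div_nonneg_of_nonpos hf hden.le) (not_le.2 hsl)
      linarith [hp.2]
    have : p₂ ≤ l ∨ p₂ ≤ p₁ := by rcases le_max_iff.1 hub with h | h <;> [exact Or.inl h; exact Or.inr h]
    rcases this with h | h
    · exact absurd h (not_le.2 hl)
    · linarith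
  · exact absurd (hall p₁) (ne_of_lt hneg)

/-! ## 2. The tangency inequality at a boundary law -/

/-- The polynomial heart: for `0 < q ≤ R`, `u ≥ 0` and `R² = q(q+t)`,
`3uq⁴(q+u) + 2tq⁴(q+t) + 3(q+u)²(q+t)R³ − 3q⁴(q+u)(q+t) − 6(t+u)q³(q+u)(q+t) ≥ 0`
(normal form `r²(1+υ)Δ = c₀ + c₁υ + c₂υ²` with `c₀, c₁, c₂ ≥ 0`); it is `> 0` as soon as `R > q`. [this work] -/
theorem key_poly {q t u R : ℝ} (hq : 0 < q) (hu : 0 ≤ u) (hRq : q ≤ R) (hR : R ^ 2 = q * (q + t)) :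
    0 ≤ 3 * u * q ^ 4 * (q + u) + 2 * t * q ^ 4 * (q + t) + 3 * (q + u) ^ 2 * (q + t) * R ^ 3
      - 3 * q ^ 4 * (q + u) * (q + t) - 6 * (t + u) * q ^ 3 * (q + u) * (q + t) ∧
    (q < R → 0 < 3 * u * q ^ 4 * (q + u) + 2 * t * q ^ 4 * (q + t) + 3 * (q + u) ^ 2 * (q + t) * R ^ 3
      - 3 * q ^ 4 * (q + u) * (q + t) - 6 * (t + u) * q ^ 3 * (q + u) * (q + t)) := by
  set Pp := 3 * u * q ^ 4 * (q + u) + 2 * t * q ^ 4 * (q + t) + 3 * (q + u) ^ 2 * (q + t) * R ^ 3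
      - 3 * q ^ 4 * (q + u) * (q + t) - 6 * (t + u) * q ^ 3 * (q + u) * (q + t) with hPp
  -- the three nonnegative pieces
  set T0 := q ^ 2 * R ^ 2 * (R - q) * (3 * R ^ 2 - q * R - q ^ 2) with hT0
  set T1 := q * u * (R - q) * (6 * R ^ 4 - 3 * q ^ 3 * R - 3 * q ^ 4) with hT1
  set T2 := 3 * u ^ 2 * (R - q) * (R ^ 4 + R ^ 3 * q + R ^ 2 * q ^ 2 - R * q ^ 3 - q ^ 4) with hT2
  have hid : Pp * q ^ 3 = (T0 + T1 + T2) * q ^ 2 +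
      (-6 * R ^ 2 * q ^ 4 * u - 4 * R ^ 2 * q ^ 5 + 3 * R ^ 3 * q ^ 2 * u ^ 2 + 6 * R ^ 3 * q ^ 3 * u + 3 * R ^ 3 * q ^ 4
        - 6 * q ^ 5 * t * u - 6 * q ^ 5 * u ^ 2 - 4 * q ^ 6 * t - 9 * q ^ 6 * u - 3 * q ^ 7) * (q * t - (R ^ 2 - q ^ 2)) := by
    rw [hPp, hT0, hT1, hT2]; ring
  have hrel : q * t - (R ^ 2 - q ^ 2) = 0 := by rw [hR]; ring
  rw [hrel, mul_zero, add_zero] at hid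
  have hRq' : 0 ≤ R - q := sub_nonneg.2 hRq
  have hR0 : 0 ≤ R := hq.le.trans hRq
  have hsq : q ^ 2 ≤ R ^ 2 := pow_le_pow_left₀ hq.le hRq 2
  have hA : 0 ≤ 3 * R ^ 2 - q * R - q ^ 2 := by
    nlinarith only [hsq, mul_nonneg hR0 hRq', sq_nonneg R]
  have hB : 0 ≤ 6 * R ^ 4 - 3 * q ^ 3 * R - 3 * q ^ 4 := by
    have h4 : q ^ 4 ≤ R ^ 4 := pow_le_pow_left₀ hq.le hRq 4
    have h3 : q ^ 3 * R ≤ R ^ 3 * R := mul_le_mul_of_nonneg_right (pow_le_pow_left₀ hq.le hRq 3) hR0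
    nlinarith only [h4, h3]
  have hC : 0 ≤ R ^ 4 + R ^ 3 * q + R ^ 2 * q ^ 2 - R * q ^ 3 - q ^ 4 := by
    have h4 : q ^ 4 ≤ R ^ 2 * q ^ 2 := by nlinarith only [hsq, sq_nonneg q]
    have h3 : R * q ^ 3 ≤ R ^ 3 * q := by nlinarith only [hsq, mul_nonneg hR0 hq.le]
    nlinarith only [h4, h3, pow_nonneg hR0 4]
  have hT0n : 0 ≤ T0 := by rw [hT0]; positivity
  have hT1n : 0 ≤ T1 := by rw [hT1]; positivity
  have hT2n : 0 ≤ T2 := by rw [hT2]; positivity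
  have hq3 : 0 < q ^ 3 := pow_pos hq 3
  have hq2 : 0 < q ^ 2 := pow_pos hq 2
  constructor
  · have h0 : 0 ≤ Pp * q ^ 3 := by rw [hid]; positivity
    by_contra h
    push Not at h
    have : Pp * q ^ 3 < 0 := mul_neg_of_neg_of_pos h hq3
    linarith
  · intro hlt
    have hpos : 0 < T0 := by
      rw [hT0]
      have h1 : 0 < R - q := sub_pos.2 hlt
      have h2 : 0 < 3 * R ^ 2 - q * R - q ^ 2 := by nlinarith only [hsq, mul_nonneg hR0 hRq', pow_pos hq 2]
      have h3 : 0 < R ^ 2 := lt_of_lt_of_le (pow_pos hq 2) hsq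
      exact mul_pos (mul_pos (mul_pos hq2 h3) h1) h2
    have h0 : 0 < Pp * q ^ 3 := by
      rw [hid]
      exact mul_pos (by linarith) hq2
    by_contra h
    push Not at h
    have : Pp * q ^ 3 ≤ 0 := mul_nonpos_of_nonpos_of_nonneg h hq3.le
    linarith

/-- **Tangency inequality.**  At a law (cells `≥ 0`, `q > 0`, total mass `1`) where the `a`-component of `(Q6)` is an EQUALITY,
the derivative of the margin along the pendant flow of `h` is `≤ 0`:
`D := −3u·I_b²I_h³I_a² − 3(x+t+u)·I_b³I_h²I_a² − 2t·I_b³I_h³I_a + 6(t+u)q⁵ ≤ 0`, and `D = 0` forces `t = 0 ∧ s = 0`. [this work] -/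
theorem key_tangency {q s t u x : ℝ} (hq : 0 < q) (hs : 0 ≤ s) (ht : 0 ≤ t) (hu : 0 ≤ u) (_hx : 0 ≤ x)
    (hsum : x + s + t + u + q = 1) (hE : q ^ 6 = (q + t) ^ 3 * (q + s) ^ 3 * (q + u) ^ 2) :
    -(3 * u * (q + t) ^ 2 * (q + s) ^ 3 * (q + u) ^ 2) - 3 * (x + t + u) * (q + t) ^ 3 * (q + s) ^ 2 * (q + u) ^ 2
        - 2 * t * (q + t) ^ 3 * (q + s) ^ 3 * (q + u) + 6 * (t + u) * q ^ 5 ≤ 0 ∧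
      (-(3 * u * (q + t) ^ 2 * (q + s) ^ 3 * (q + u) ^ 2) - 3 * (x + t + u) * (q + t) ^ 3 * (q + s) ^ 2 * (q + u) ^ 2
        - 2 * t * (q + t) ^ 3 * (q + s) ^ 3 * (q + u) + 6 * (t + u) * q ^ 5 = 0 → t = 0 ∧ s = 0) := by
  set A := q + u with hA
  set B := q + t with hB
  set H := q + s with hH
  have hA0 : 0 < A := by rw [hA]; exact add_pos_of_pos_of_nonneg hq hu
  have hB0 : 0 < B := by rw [hB]; exact add_pos_of_pos_of_nonneg hq ht
  have hH0 : 0 < H := by rw [hH]; exact add_pos_of_pos_of_nonneg hq hs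
  have hHq : q ≤ H := by rw [hH]; exact le_add_of_nonneg_right hs
  have hv : x + t + u = 1 - H := by rw [hH]; linarith only [hsum]
  -- Step 1: `q⁵ ≥ A²B³H²` (from the boundary equation and `H ≥ q`)
  have h5 : A ^ 2 * B ^ 3 * H ^ 2 ≤ q ^ 5 := by
    have h0 : 0 ≤ A ^ 2 * B ^ 3 * H ^ 2 := by positivity
    have : A ^ 2 * B ^ 3 * H ^ 2 * q ≤ A ^ 2 * B ^ 3 * H ^ 2 * H := mul_le_mul_of_nonneg_left hHq h0
    have e : A ^ 2 * B ^ 3 * H ^ 2 * H = q ^ 5 * q := by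
      rw [show q ^ 5 * q = q ^ 6 by ring, hE]; ring
    rw [e] at this
    exact le_of_mul_le_mul_right this hq
  -- Step 2: `R = √(qB)`, `q ≤ R`
  set R := Real.sqrt (q * B) with hRdef
  have hqB : 0 ≤ q * B := by positivity
  have hR2 : R ^ 2 = q * (q + t) := by rw [hRdef, Real.sq_sqrt hqB]
  have hR0 : 0 ≤ R := Real.sqrt_nonneg _
  have hRq : q ≤ R := by
    have : q ^ 2 ≤ R ^ 2 := by rw [hR2]; nlinarith only [mul_nonneg hq.le ht]
    exact (pow_le_pow_iff_left₀ hq.le hR0 two_ne_zero).1 this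
  -- Step 3: `A R³ H ≤ q⁴`
  have h4 : A * R ^ 3 * H ≤ q ^ 4 := by
    have hl : 0 ≤ A * R ^ 3 * H := by positivity
    have hsq : (A * R ^ 3 * H) ^ 2 ≤ (q ^ 4) ^ 2 := by
      have e : (A * R ^ 3 * H) ^ 2 = q ^ 3 * (A ^ 2 * B ^ 3 * H ^ 2) := by
        have : (R ^ 3) ^ 2 = (R ^ 2) ^ 3 := by ring
        calc (A * R ^ 3 * H) ^ 2 = A ^ 2 * (R ^ 2) ^ 3 * H ^ 2 := by ring
          _ = A ^ 2 * (q * (q + t)) ^ 3 * H ^ 2 := by rw [hR2]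
          _ = q ^ 3 * (A ^ 2 * B ^ 3 * H ^ 2) := by rw [hB]; ring
      rw [e]
      calc q ^ 3 * (A ^ 2 * B ^ 3 * H ^ 2) ≤ q ^ 3 * q ^ 5 := mul_le_mul_of_nonneg_left h5 (by positivity)
        _ = (q ^ 4) ^ 2 := by ring
    exact (pow_le_pow_iff_left₀ hl (by positivity) two_ne_zero).1 hsq
  -- Step 4: the polynomial inequality
  obtain ⟨hP, hPstrict⟩ := key_poly (t := t) (u := u) hq hu hRq hR2
  -- Step 5: assemble.  `D · (A B H) = −q⁵ · G` with `q³ · G = H · P + 3AB(q⁴ − A R³ H)`.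
  have hG : 0 ≤ q * (3 * u * A * H + 2 * t * B * H + 3 * A * B) - 3 * q * A * B * H - 6 * (t + u) * A * B * H := by
    have e : q ^ 3 * (q * (3 * u * A * H + 2 * t * B * H + 3 * A * B) - 3 * q * A * B * H - 6 * (t + u) * A * B * H) =
        H * (3 * u * q ^ 4 * (q + u) + 2 * t * q ^ 4 * (q + t) + 3 * (q + u) ^ 2 * (q + t) * R ^ 3
          - 3 * q ^ 4 * (q + u) * (q + t) - 6 * (t + u) * q ^ 3 * (q + u) * (q + t)) + 3 * A * B * (q ^ 4 - A * R ^ 3 * H) := by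
      rw [hA, hB]; ring
    have : 0 ≤ q ^ 3 * (q * (3 * u * A * H + 2 * t * B * H + 3 * A * B) - 3 * q * A * B * H - 6 * (t + u) * A * B * H) := by
      rw [e]
      have : 0 ≤ 3 * A * B * (q ^ 4 - A * R ^ 3 * H) := by
        have : 0 ≤ q ^ 4 - A * R ^ 3 * H := sub_nonneg.2 h4
        positivity
      positivity
    exact le_of_mul_le_mul_left (by rw [mul_zero]; exact this) (pow_pos hq 3)
  have hD : -(3 * u * B ^ 2 * H ^ 3 * A ^ 2) - 3 * (x + t + u) * B ^ 3 * H ^ 2 * A ^ 2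
        - 2 * t * B ^ 3 * H ^ 3 * A + 6 * (t + u) * q ^ 5 =
      -(q ^ 5 * (q * (3 * u * A * H + 2 * t * B * H + 3 * A * B) - 3 * q * A * B * H - 6 * (t + u) * A * B * H))
        / (A * B * H) := by
    rw [eq_div_iff (by positivity : A * B * H ≠ 0), hv]
    -- replace the three products of `I`'s by `q⁶ ·` something
    have e1 : B ^ 2 * H ^ 3 * A ^ 2 * (A * B * H) = q ^ 6 * (A * H) := by rw [hE]; ring
    have e2 : B ^ 3 * H ^ 2 * A ^ 2 * (A * B * H) = q ^ 6 * (A * B) := by rw [hE]; ring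
    have e3 : B ^ 3 * H ^ 3 * A * (A * B * H) = q ^ 6 * (B * H) := by rw [hE]; ring
    calc (-(3 * u * B ^ 2 * H ^ 3 * A ^ 2) - 3 * (1 - H) * B ^ 3 * H ^ 2 * A ^ 2 - 2 * t * B ^ 3 * H ^ 3 * A
          + 6 * (t + u) * q ^ 5) * (A * B * H)
        = -(3 * u) * (B ^ 2 * H ^ 3 * A ^ 2 * (A * B * H)) - 3 * (1 - H) * (B ^ 3 * H ^ 2 * A ^ 2 * (A * B * H))
          - 2 * t * (B ^ 3 * H ^ 3 * A * (A * B * H)) + 6 * (t + u) * q ^ 5 * (A * B * H) := by ring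
      _ = -(3 * u) * (q ^ 6 * (A * H)) - 3 * (1 - H) * (q ^ 6 * (A * B)) - 2 * t * (q ^ 6 * (B * H))
          + 6 * (t + u) * q ^ 5 * (A * B * H) := by rw [e1, e2, e3]
      _ = -(q ^ 5 * (q * (3 * u * A * H + 2 * t * B * H + 3 * A * B) - 3 * q * A * B * H - 6 * (t + u) * A * B * H)) := by
          ring
  constructor
  · rw [hD, div_le_iff₀ (by positivity), zero_mul, neg_nonpos]
    exact mul_nonneg (pow_nonneg hq.le 5) hG
  · intro hD0
    rw [hD, div_eq_zero_iff] at hD0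
    rcases hD0 with hD0 | hD0
    · rw [neg_eq_zero, mul_eq_zero] at hD0
      rcases hD0 with hq5 | hG0
      · exact absurd hq5 (pow_ne_zero 5 hq.ne')
      · -- `G = 0` forces both `H = q` (so `s = 0`) and `P = 0` (so `R = q`, i.e. `t = 0`)
        have e : q ^ 3 * (q * (3 * u * A * H + 2 * t * B * H + 3 * A * B) - 3 * q * A * B * H - 6 * (t + u) * A * B * H) =
            H * (3 * u * q ^ 4 * (q + u) + 2 * t * q ^ 4 * (q + t) + 3 * (q + u) ^ 2 * (q + t) * R ^ 3
              - 3 * q ^ 4 * (q + u) * (q + t) - 6 * (t + u) * q ^ 3 * (q + u) * (q + t)) + 3 * A * B * (q ^ 4 - A * R ^ 3 * H) := by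
          rw [hA, hB]; ring
        rw [hG0, mul_zero] at e
        have h4' : 0 ≤ 3 * A * B * (q ^ 4 - A * R ^ 3 * H) := by
          have : 0 ≤ q ^ 4 - A * R ^ 3 * H := sub_nonneg.2 h4
          positivity
        have hHP0 : 0 ≤ H * (3 * u * q ^ 4 * (q + u) + 2 * t * q ^ 4 * (q + t) + 3 * (q + u) ^ 2 * (q + t) * R ^ 3
              - 3 * q ^ 4 * (q + u) * (q + t) - 6 * (t + u) * q ^ 3 * (q + u) * (q + t)) := mul_nonneg hH0.le hP
        have hHP : H * (3 * u * q ^ 4 * (q + u) + 2 * t * q ^ 4 * (q + t) + 3 * (q + u) ^ 2 * (q + t) * R ^ 3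
              - 3 * q ^ 4 * (q + u) * (q + t) - 6 * (t + u) * q ^ 3 * (q + u) * (q + t)) = 0 := by
          linarith only [e, hHP0, h4']
        have hP0 : 3 * u * q ^ 4 * (q + u) + 2 * t * q ^ 4 * (q + t) + 3 * (q + u) ^ 2 * (q + t) * R ^ 3
              - 3 * q ^ 4 * (q + u) * (q + t) - 6 * (t + u) * q ^ 3 * (q + u) * (q + t) = 0 :=
          (mul_eq_zero.1 hHP).resolve_left hH0.ne'
        have h3AB : 3 * A * B * (q ^ 4 - A * R ^ 3 * H) = 0 := by linarith only [e, hHP0, h4', hHP]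
        have hR4 : q ^ 4 - A * R ^ 3 * H = 0 := by
          rcases mul_eq_zero.1 h3AB with h | h
          · rcases mul_eq_zero.1 h with h' | h'
            · rcases mul_eq_zero.1 h' with h'' | h''
              · norm_num at h''
              · exact absurd h'' hA0.ne'
            · exact absurd h' hB0.ne'
          · exact h
        -- `t = 0`: otherwise `R > q` and `P > 0`
        have ht0 : t = 0 := by
          by_contra htne
          have htpos : 0 < t := lt_of_le_of_ne ht (Ne.symm htne)
          have hRlt : q < R := by
            have : q ^ 2 < R ^ 2 := by rw [hR2]; nlinarith only [mul_pos hq htpos]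
            exact (pow_lt_pow_iff_left₀ hq.le hR0 two_ne_zero).1 this
          linarith only [hPstrict hRlt, hP0]
        -- `s = 0`: otherwise `H > q` and `q⁵ > A²B³H²`, `q⁴ > A R³ H`
        have hs0 : s = 0 := by
          by_contra hsne
          have hspos : 0 < s := lt_of_le_of_ne hs (Ne.symm hsne)
          have hHlt : q < H := by rw [hH]; linarith only [hspos]
          have h5s : A ^ 2 * B ^ 3 * H ^ 2 < q ^ 5 := by
            have h0 : 0 < A ^ 2 * B ^ 3 * H ^ 2 := by positivity
            have : A ^ 2 * B ^ 3 * H ^ 2 * q < A ^ 2 * B ^ 3 * H ^ 2 * H := mul_lt_mul_of_pos_left hHlt h0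
            have e' : A ^ 2 * B ^ 3 * H ^ 2 * H = q ^ 5 * q := by
              rw [show q ^ 5 * q = q ^ 6 by ring, hE]; ring
            rw [e'] at this
            exact lt_of_mul_lt_mul_right this hq.le
          have h4s : A * R ^ 3 * H < q ^ 4 := by
            have hl : 0 ≤ A * R ^ 3 * H := by positivity
            have hsq : (A * R ^ 3 * H) ^ 2 < (q ^ 4) ^ 2 := by
              have e' : (A * R ^ 3 * H) ^ 2 = q ^ 3 * (A ^ 2 * B ^ 3 * H ^ 2) := by
                calc (A * R ^ 3 * H) ^ 2 = A ^ 2 * (R ^ 2) ^ 3 * H ^ 2 := by ring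
                  _ = A ^ 2 * (q * (q + t)) ^ 3 * H ^ 2 := by rw [hR2]
                  _ = q ^ 3 * (A ^ 2 * B ^ 3 * H ^ 2) := by rw [hB]; ring
              rw [e']
              calc q ^ 3 * (A ^ 2 * B ^ 3 * H ^ 2) < q ^ 3 * q ^ 5 := mul_lt_mul_of_pos_left h5s (pow_pos hq 3)
                _ = (q ^ 4) ^ 2 := by ring
            exact (pow_lt_pow_iff_left₀ hl (by positivity) two_ne_zero).1 hsq
          have : 0 < 3 * A * B * (q ^ 4 - A * R ^ 3 * H) := by
            have : 0 < q ^ 4 - A * R ^ 3 * H := sub_pos.2 h4s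
            positivity
          rw [hR4, mul_zero] at this
          exact lt_irrefl _ this
        exact ⟨ht0, hs0⟩
    · exact absurd hD0 (by positivity)

end Summit.CriticalPhenomena.PercolationContinuityZ3.Theorems.ThreePointIsoSexticPendantFlow
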